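import Literature.MathematicalPhysics.PowerSystems.NonuniformKuramotoConnectivityCondition
import Literature.MathematicalPhysics.PowerSystems.KronReductionSpectralInterlacing
import HarnessLib

/-!
# Dörfler–Bullo's synchronization condition II and frequency synchronization with the algebraic
# connectivity `λ₂(L(Pᵢⱼ cos φᵢⱼ))` BY NAME (SICON 2012 Thm 5.5 / Thm 5.1 2), Lemma 5.9)

Topic `Literature/MathematicalPhysics/PowerSystems`; namespaces `…PowerSystems` (§1 coupling
Laplacian, Lemma 5.9), `…PowerSystems.NonuniformKuramoto` (§2), `…PowerSystems.DroopNetwork` (§3).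
A BY-NAME UPGRADE of `NonuniformKuramotoConnectivityCondition.lean` (gridfusion-lit-1 g5): every
theorem there takes the algebraic connectivity through the CERTIFICATE hypothesis
`hlam : ∀ v, λ‖Hv‖₂² ≤ n·½ΣΣ Pᵢⱼcos φᵢⱼ (vᵢ−vⱼ)²` («this is Lemma 5.9, for any
`λ ≤ λ₂(L(Pᵢⱼ cos φᵢⱼ))`» — asserted in its docstrings, not proved there); with Fiedler's variational
formula now in the tree (`KronReductionSpectralInterlacing` §5, `pairCertificate_of_le_algConn` /
`le_algConn_of_pairCertificate`) this file PROVES Lemma 5.9 with `λ₂` by name and restates Thm 5.5 1),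
Thm 5.1 2) and their droop-microgrid twins with the hypothesis `λ ≤ λ₂(L(Pᵢⱼ cos φᵢⱼ))` on Mathlib's
sorted spectrum — the printed form «`λ₂(L(Pᵢⱼ cos φᵢⱼ)) > λ_critical`».  Everything below is PROVED:
0 definitions, 0 named facts, 0 `sorry`, no new axiom; the dynamics theorems are the tree's, reused
unchanged (`NonuniformKuramoto.two_norm_cohesive`, `frequency_sync_to_syncFreq`,
`DroopNetwork.two_norm_cohesive`, `disagreement_decay`).

SOURCE (read on the page, `lit read paper:arxiv-0910.5673` = [DorflerBullo2012], F. Dörfler, F. Bullo,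
SIAM J. Control Optim. 50 (2012) 1616–1642, long arXiv version).  §2 (p0005 L32–L38): «The Laplacian
equals then the symmetric matrix `L(aᵢⱼ) = Hᵀdiag(w_k)H`. If `𝒢` is connected, then `ker(H) =
ker(L(aᵢⱼ)) = span(𝟙_n)`, all `n−1` remaining non-zero eigenvalues … are strictly positive, and the
second-smallest eigenvalue `λ₂(L(aᵢⱼ))` is called the algebraic connectivity of `𝒢`».  **Theorem 5.5
(Synchronization condition II)** (p0021 L57–L110): «Consider the non-uniform Kuramoto model, where
the graph induced by `P = Pᵀ` is connected. Let `H` be the incidence matrix of the complete graph and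
assume that the algebraic connectivity of the lossless coupling is larger than a critical value, i.e.,
`λ₂(L(Pᵢⱼcos(φᵢⱼ))) > λ_critical := (‖HD⁻¹ω‖₂ + √n‖[Σⱼ(P_1j/D_1)sin φ_1j, …]‖₂)/(cos(φ_max)(κ/n)α/
max_{i≠j}{DᵢDⱼ})` … Then … 1) phase cohesiveness … 2) frequency synchronization …».  **Lemma 5.9**
(p0022 L89–L110, p0023 L1–L8): «Consider a connected graph with `n` nodes induced by `A = Aᵀ` with
incidence matrix `B` and Laplacian `L(Aᵢⱼ)`. For any `x ∈ ℝⁿ`, it holds that `(Bx)ᵀdiag(Aᵢⱼ)(Bx) ≥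
(λ₂(L(Aᵢⱼ))/n)‖Bx‖₂²`. Proof. … `xᵀL(Aᵢⱼ)x ≥ λ₂(L(Aᵢⱼ))‖x_⊥‖₂² = (λ₂/n²)‖HᵀHx‖₂² = … (λ₂/n)‖Hx‖₂²` …
Finally, note that `‖Hx‖₂² ≥ ‖Bx‖₂²`».  §5.1 Thm 5.1 2) / eq. (rate λ_fe) (p0016 L58): «the factor
`λ₂(L(Pᵢⱼ))` is the algebraic connectivity of the graph induced by `P = Pᵀ`».
[SimpsonporcoDorflerBullo2013] arXiv:1206.5033 §3 Lemma 1 (droop-controlled inverters are non-uniform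
Kuramoto oscillators) — through the tree's `DroopNetwork.toKuramoto`.

RENDERING.  The coupling Laplacian of symmetric weights `a : Fin n → Fin n → ℝ` is spelled out as the
matrix `diagonal (fun i => Σⱼ a i j) − Matrix.of a` (`= Hᵀdiag(a)H`; the diagonal of `a` is
immaterial); `λ₂` is Mathlib's `IsHermitian.eigenvalues₀ ⟨n − 2, _⟩` (decreasing enumeration, the
second-SMALLEST), `n ≥ 2`; the `IsHermitian` proof is a hypothesis (KyFan style; it holds by
`isHermitian_diagonal` and symmetry of `a`).  `‖Hv‖₂² = pairNormSq v = ½ΣΣ(vᵢ − vⱼ)²` (tree).  The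
theorems take ANY `λ` with `0 ≤ λ ≤ λ₂` (what a certified eigenvalue enclosure delivers); the
`λ = λ₂` instance is `two_norm_cohesive_algConn`.

WHAT IS PROVED (0 `def`, 0 named facts, 0 `sorry`):
* §1 `couplingLaplacian_form` (`xᵀ(diag(a𝟙) − a)x = ½ΣΣaᵢⱼ(xᵢ−xⱼ)²`), `couplingLaplacian_rowsum`,
  `couplingLaplacian_form_nonneg`, ★★★ **`pairCertificate_of_le_algConn_weights`** (LEMMA 5.9 with
  `λ₂` BY NAME, in the tree's `‖Hx‖` currency: every `λ ≤ λ₂(L(a))` gives `λ‖Hv‖₂² ≤ n·½ΣΣaᵢⱼ(vᵢ−vⱼ)²`),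
  ★★ `le_algConn_of_pairCertificate_weights` (converse: `λ₂` is the best constant), ★
  `algConn_weights_nonneg`.
* §2 ★★★ **`NonuniformKuramoto.two_norm_cohesive_of_le_algConn`** (THM 5.5 1) with
  `λ ≤ λ₂(L(Pᵢⱼcos φᵢⱼ))`), ★★ `two_norm_cohesive_algConn` (`λ = λ₂`: the printed
  «`λ₂ > λ_critical`» form, `hkey` with `λ₂` in place of `λ`), ★★★
  **`frequency_sync_of_le_algConn`** (THM 5.1 2) / 5.5 2): exponential frequency synchronization with
  rate `λ cos γ κ²/(nΣDᵢ²D_max)`, `λ ≤ λ₂(L(Pᵢⱼ))`).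
* §3 droop microgrid (`DroopNetwork`, SPDB2013 Lemma 1): ★★★ **`two_norm_cohesive_of_le_algConn`**, ★★★
  **`disagreement_decay_of_le_algConn`** — the same with `λ₂(L(aᵢⱼ))`, `aᵢⱼ = EᵢEⱼ|Yᵢⱼ|`.

PROOF ROUTE.  Lemma 5.9 = Fiedler's variational formula for the PSD loop-less matrix `diag(a𝟙) − a`
(`KronReduction.pairCertificate_of_le_algConn`, proved from Courant–Fischer in
`KronReductionSpectralInterlacing` §5) after identifying its form with `½ΣΣaᵢⱼ(xᵢ−xⱼ)²`; the source's
detour through `HᵀH` and `‖Hx‖ ≥ ‖Bx‖` is not needed because the tree's certificate is already stated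
with `‖Hx‖`.  §2–§3 feed the certificate into the tree's theorems verbatim.  Exact cross-check of the
bridge: `negtest/kron_interlacing_check.py` part (e) (seat folder; `cert(λ) ⟺ #{eigenvalues < λ} ≤ 1`
on random weighted Laplacians, Sturm counts, 0 failures).

THREE COLUMNS.  CERTIFIED (kernel theorems): for the non-uniform Kuramoto model / lossless droop
microgrid with exact data, `λ ≤ λ₂(L(Pᵢⱼcos φᵢⱼ))` and `M·M_H < κ(sin ρ/ρ)(λ/n)μ` (+ the geometric
side conditions) give phase cohesiveness in `Δ̄(ρ)` and exponential frequency synchronization — the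
printed Theorem 5.5 with `λ₂` by name; a certificate consumer supplies EITHER a certified enclosure
`λ ≤ λ₂` (certnum interval eigenvalue bound) OR the `n × n` PSD certificate of the older file (both
are now proved equivalent to `λ ≤ λ₂`).  VALIDATED: nothing numerical.  MODELLED: first-order
non-uniform Kuramoto (overdamped classical model, D–B §3), lossless droop inverters with constant
amplitudes and no load buses (SPDB2013); nothing says a grid is stable beyond these models and the
stated perturbation class (initial conditions with `M‖Hθ(0)‖₂² ≤ mρ²`).  NOT CLAIMED: the
second-order (singular-perturbation) statements 3)–4) of Thm 3.2/5.5, the `∞`-norm condition I (tree: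
`NonuniformKuramotoSyncCondition`), `λ₂(L) = n` for the complete uniform graph, connectivity ⟺
`λ₂ > 0` for weighted graphs (Mathlib has the unweighted `SimpleGraph` version).

## References
* [DorflerBullo2012] F. Dörfler, F. Bullo, *Synchronization and transient stability in power networks
  and non-uniform Kuramoto oscillators*, SIAM J. Control Optim. 50 (2012) 1616–1642,
  doi:10.1137/110851584, arXiv:0910.5673 — §2 (algebraic connectivity), §5.1 Thm 5.1 2), §5.2 Thm 5.5,
  Lemma 5.9 with proof.
* [SimpsonporcoDorflerBullo2013] J. W. Simpson-Porco, F. Dörfler, F. Bullo, *Synchronization and power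
  sharing for droop-controlled inverters in islanded microgrids*, Automatica 49 (2013) 2603–2611,
  arXiv:1206.5033 — §3 Lemma 1, Thm 2.
* [BrouwerHaemers2012] A. E. Brouwer, W. H. Haemers, *Spectra of Graphs*, Springer 2012 — §1.7.
* [HornJohnson2013] R. A. Horn, C. R. Johnson, *Matrix Analysis*, 2nd ed., CUP 2013 — Thm. 4.2.6.
-/

noncomputable section

open Set Finset Matrix

namespace Literature.MathematicalPhysics.PowerSystems

open Literature.Analysis.Matrix
open KronReduction

/-! ### §1. Lemma 5.9: the coupling Laplacian `L(a)` of symmetric non-negative weights and its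
algebraic connectivity `λ₂(L(a))` as the optimal pair certificate -/

section CouplingLaplacian

variable {n : ℕ}

/-- **`L(a) = Bᵀdiag(aᵢⱼ)B` as a quadratic form**: `xᵀ(diag(a𝟙) − a)x = ½ΣΣ aᵢⱼ(xᵢ − xⱼ)²` for
symmetric weights. [cite: DorflerBullo2012, arXiv:0910.5673 §5.2 proof of Lemma 5.9 («`L(Aᵢⱼ) = Bᵀdiag(Aᵢⱼ)B` is the Laplacian»)] -/
theorem couplingLaplacian_form (a : Fin n → Fin n → ℝ) (ha : ∀ i j, a i j = a j i) (x : Fin n → ℝ) :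
    x ⬝ᵥ (diagonal (fun i => ∑ j, a i j) - Matrix.of a) *ᵥ x
      = 1 / 2 * ∑ i, ∑ j, a i j * (x i - x j) ^ 2 := by
  have h1 : x ⬝ᵥ (diagonal (fun i => ∑ j, a i j) - Matrix.of a) *ᵥ x
      = ∑ i, (∑ j, a i j) * x i ^ 2 - ∑ i, ∑ j, a i j * (x i * x j) := by
    rw [sub_mulVec, dotProduct_sub]
    congr 1
    · simp only [dotProduct, mulVec_diagonal]
      exact sum_congr rfl fun i _ => by ring
    · simp only [dotProduct, mulVec, of_apply, mul_sum]
      exact sum_congr rfl fun i _ => sum_congr rfl fun j _ => by ring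
  have h2 : ∑ i, ∑ j, a i j * x j ^ 2 = ∑ i, ∑ j, a i j * x i ^ 2 := by
    rw [sum_comm]
    exact sum_congr rfl fun i _ => sum_congr rfl fun j _ => by rw [ha]
  have h3 : ∑ i, (∑ j, a i j) * x i ^ 2 = ∑ i, ∑ j, a i j * x i ^ 2 :=
    sum_congr rfl fun i _ => by rw [sum_mul]
  have h4 : ∑ i, ∑ j, a i j * (x i - x j) ^ 2
      = ∑ i, ∑ j, a i j * x i ^ 2 - 2 * ∑ i, ∑ j, a i j * (x i * x j)
        + ∑ i, ∑ j, a i j * x j ^ 2 := by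
    have : ∀ i j, a i j * (x i - x j) ^ 2
        = a i j * x i ^ 2 - 2 * (a i j * (x i * x j)) + a i j * x j ^ 2 := fun i j => by ring
    simp only [this, sum_add_distrib, sum_sub_distrib, mul_sum]
  rw [h1, h3, h4, h2]; ring

/-- The coupling Laplacian has zero row sums (loop-less). [cite: DorflerBullo2012, arXiv:0910.5673 §5.2 Lemma 5.9 («the Laplacian matrix»)] -/
theorem couplingLaplacian_rowsum (a : Fin n → Fin n → ℝ) (i : Fin n) :
    ∑ j, (diagonal (fun i => ∑ j, a i j) - Matrix.of a) i j = 0 := by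
  simp [Matrix.sub_apply, sum_sub_distrib, diagonal_apply, of_apply]

/-- The coupling Laplacian of non-negative symmetric weights is positive semidefinite (as a form).
[cite: DorflerBullo2012, arXiv:0910.5673 §5.2 Lemma 5.9] -/
theorem couplingLaplacian_form_nonneg (a : Fin n → Fin n → ℝ) (ha : ∀ i j, a i j = a j i)
    (ha0 : ∀ i j, 0 ≤ a i j) (x : Fin n → ℝ) :
    0 ≤ x ⬝ᵥ (diagonal (fun i => ∑ j, a i j) - Matrix.of a) *ᵥ x := by
  rw [couplingLaplacian_form a ha]
  exact mul_nonneg (by norm_num) (sum_nonneg fun i _ => sum_nonneg fun j _ =>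
    mul_nonneg (ha0 i j) (sq_nonneg _))

/-- ★★★ **LEMMA 5.9 with `λ₂` BY NAME**: for symmetric non-negative weights `aᵢⱼ` on `n ≥ 2` nodes
and EVERY `λ ≤ λ₂(L(aᵢⱼ))` (`λ₂ = λ↓_{n−2}`, the second-smallest eigenvalue of the coupling Laplacian
`L(a) = diag(a𝟙) − a`), `λ·‖Hv‖₂² ≤ n·½ΣΣ aᵢⱼ(vᵢ − vⱼ)²` for all `v` — «`(Bx)ᵀdiag(Aᵢⱼ)(Bx) ≥
(λ₂(L(Aᵢⱼ))/n)‖Hx‖₂²`».  This DISCHARGES the hypothesis `hlam` of every theorem of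
`NonuniformKuramotoConnectivityCondition` from the algebraic connectivity (or any certified lower
bound of it).
[cite: DorflerBullo2012, arXiv:0910.5673 §5.2 Lemma 5.9 with proof (p0022–p0023); BrouwerHaemers2012, §1.7 (variational formula, held text p0027)] -/
theorem pairCertificate_of_le_algConn_weights (hn : 2 ≤ n) (a : Fin n → Fin n → ℝ)
    (ha : ∀ i j, a i j = a j i) (ha0 : ∀ i j, 0 ≤ a i j)
    (hL : (diagonal (fun i => ∑ j, a i j) - Matrix.of a).IsHermitian) {lam : ℝ}
    (hle : lam ≤ hL.eigenvalues₀ ⟨n - 2, by simp; omega⟩) (v : Fin n → ℝ) :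
    lam * pairNormSq v ≤ n * (1 / 2 * ∑ i, ∑ j, a i j * (v i - v j) ^ 2) := by
  have hn' : 2 ≤ Fintype.card (Fin n) := by simpa using hn
  have h := pairCertificate_of_le_algConn hL (couplingLaplacian_rowsum a)
    (couplingLaplacian_form_nonneg a ha ha0) hn'
    (lam := lam) (by convert hle using 2; simp) v
  rw [couplingLaplacian_form a ha, Fintype.card_fin] at h
  exact h

/-- ★★ **… and `λ₂` is the BEST constant**: any admissible `λ` in `hlam` is `≤ λ₂(L(aᵢⱼ))` (`n ≥ 2`,
symmetric weights; no sign needed).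
[cite: DorflerBullo2012, arXiv:0910.5673 §5.2 Lemma 5.9; HornJohnson2013, Thm. 4.2.6 (Courant–Fischer), held text p0305] -/
theorem le_algConn_of_pairCertificate_weights (hn : 2 ≤ n) (a : Fin n → Fin n → ℝ)
    (ha : ∀ i j, a i j = a j i)
    (hL : (diagonal (fun i => ∑ j, a i j) - Matrix.of a).IsHermitian) {lam : ℝ}
    (hlam : ∀ v : Fin n → ℝ, lam * pairNormSq v ≤ n * (1 / 2 * ∑ i, ∑ j, a i j * (v i - v j) ^ 2)) :
    lam ≤ hL.eigenvalues₀ ⟨n - 2, by simp; omega⟩ := by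
  have hn' : 2 ≤ Fintype.card (Fin n) := by simpa using hn
  have h := le_algConn_of_pairCertificate hL hn' (lam := lam) (fun z => by
    rw [couplingLaplacian_form a ha, Fintype.card_fin]; exact hlam z)
  convert h using 2; simp

/-- ★ `λ₂(L(a)) ≥ 0` for non-negative symmetric weights. [cite: BrouwerHaemers2012, §1.7 («`μ₂(Γ) ≥ 0`», held text p0027)] -/
theorem algConn_weights_nonneg (hn : 2 ≤ n) (a : Fin n → Fin n → ℝ)
    (ha : ∀ i j, a i j = a j i) (ha0 : ∀ i j, 0 ≤ a i j)
    (hL : (diagonal (fun i => ∑ j, a i j) - Matrix.of a).IsHermitian) :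
    0 ≤ hL.eigenvalues₀ ⟨n - 2, by simp; omega⟩ :=
  eigenvalues₀_nonneg_of_form_nonneg hL (couplingLaplacian_form_nonneg a ha ha0) _

end CouplingLaplacian

/-! ### §2. Theorem 5.5 (Synchronization condition II) and Theorem 5.1 2) with `λ₂(L(Pᵢⱼ cos φᵢⱼ))`
BY NAME -/

namespace NonuniformKuramoto

variable {n : ℕ} (K : NonuniformKuramoto n)

/-- ★★★ **THEOREM 5.5 1) (phase cohesiveness) WITH THE ALGEBRAIC CONNECTIVITY BY NAME**: the tree's
`two_norm_cohesive` with its connectivity certificate `hlam` DISCHARGED from any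
`λ ≤ λ₂(L(Pᵢⱼ cos φᵢⱼ))` (`λ ≥ 0`), `L(Pᵢⱼ cos φᵢⱼ) = diag(Σⱼ Pᵢⱼcos φᵢⱼ) − (Pᵢⱼ cos φᵢⱼ)` the
coupling Laplacian, `λ₂` its second-smallest eigenvalue (Mathlib `eigenvalues₀ ⟨n−2⟩`, decreasing
enumeration).  All other hypotheses and both conclusions verbatim as in `two_norm_cohesive`: if
`M·M_H < κ (sin ρ/ρ)(λ/n) μ` then (i) `‖Hθ(t)‖₂ ≤ ρ`, `θ(t) ∈ Δ̄(ρ)` on `[0, T]` from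
`M‖Hθ(0)‖₂² ≤ mρ²`, (ii) the strict decrease to the terminal set.  With `λ = λ₂` this is the printed
«if `λ₂(L(Pᵢⱼ cos φᵢⱼ)) > λ_critical`» form; with a certified enclosure `λ ≤ λ₂` it is what a
certificate pipeline consumes.
[cite: DorflerBullo2012, arXiv:0910.5673 §5.2 Thm 5.5 (Synchronization condition II) statement 1) (p0021 L57–L110) with Lemma 5.9 (p0022–p0023)] -/
theorem two_norm_cohesive_of_le_algConn (hn : 2 ≤ n) (hD : ∀ i, 0 < K.D i) (hP : ∀ i j, 0 ≤ K.P i j)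
    (hφ0 : ∀ i j, 0 ≤ K.φ i j) (hφ : ∀ i j, K.φ i j ≤ Real.pi / 2)
    (hsymm : ∀ i j, K.P i j * Real.cos (K.φ i j) = K.P j i * Real.cos (K.φ j i))
    (hL : (diagonal (fun i => ∑ j, K.P i j * Real.cos (K.φ i j))
      - Matrix.of (fun i j => K.P i j * Real.cos (K.φ i j))).IsHermitian)
    {ρ μ m M MH lam T : ℝ} (hρ0 : 0 < ρ) (hρπ : ρ ≤ Real.pi) (hμ : 0 < μ)
    (hm0 : 0 < m) (hm : ∀ i j, i ≠ j → m ≤ K.D i * K.D j) (hM : ∀ i j, i ≠ j → K.D i * K.D j ≤ M)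
    (hMnn : 0 ≤ M) (hsq : M * μ ^ 2 ≤ m * ρ ^ 2) (hMH0 : 0 ≤ MH)
    (hMH : 1 / 2 * ∑ i, ∑ j,
      (|K.ω i / K.D i - K.ω j / K.D j| + ∑ k, K.b i k + ∑ k, K.b j k) ^ 2 ≤ MH ^ 2)
    (hlam0 : 0 ≤ lam) (hle : lam ≤ hL.eigenvalues₀ ⟨n - 2, by simp; omega⟩)
    (hkey : M * MH < K.kappa * (Real.sin ρ / ρ) * (lam / n) * μ)
    {θ : ℝ → Fin n → ℝ} (hθ : ∀ t ∈ Icc 0 T, HasDerivWithinAt θ (K.field (θ t)) (Icc 0 T) t)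
    (h0 : M * pairNormSq (θ 0) ≤ m * ρ ^ 2) :
    (∀ t ∈ Icc 0 T, pairNormSq (θ t) ≤ ρ ^ 2 ∧ θ t ∈ arcPolytope n ρ) ∧
    (T ≤ (m * ρ ^ 2 - M * μ ^ 2) / (μ * (K.kappa * (Real.sin ρ / ρ) * (lam / n) * μ - M * MH)) →
      ∀ t ∈ Icc 0 T, m * pairNormSq (θ t)
        ≤ m * ρ ^ 2 - μ * (K.kappa * (Real.sin ρ / ρ) * (lam / n) * μ - M * MH) * t) := by
  have hw0 : ∀ i j, 0 ≤ K.P i j * Real.cos (K.φ i j) := fun i j =>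
    mul_nonneg (hP i j) (Real.cos_nonneg_of_mem_Icc ⟨by linarith [hφ0 i j, Real.pi_pos], hφ i j⟩)
  have hlam := pairCertificate_of_le_algConn_weights hn _ hsymm hw0 hL hle
  exact K.two_norm_cohesive hD hP hφ0 hφ hsymm hρ0 hρπ hμ hm0 hm hM hMnn hsq hMH0 hMH hlam0 hlam hkey
    hθ h0

/-- ★★ **THEOREM 5.5 1) WITH `λ = λ₂(L(Pᵢⱼ cos φᵢⱼ))` ITSELF** (the printed condition
`λ₂ > λ_critical` is `hkey` with `λ := λ₂`; `λ₂ ≥ 0` is automatic).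
[cite: DorflerBullo2012, arXiv:0910.5673 §5.2 Thm 5.5 statement 1) (p0021 L57–L110), Lemma 5.9] -/
theorem two_norm_cohesive_algConn (hn : 2 ≤ n) (hD : ∀ i, 0 < K.D i) (hP : ∀ i j, 0 ≤ K.P i j)
    (hφ0 : ∀ i j, 0 ≤ K.φ i j) (hφ : ∀ i j, K.φ i j ≤ Real.pi / 2)
    (hsymm : ∀ i j, K.P i j * Real.cos (K.φ i j) = K.P j i * Real.cos (K.φ j i))
    (hL : (diagonal (fun i => ∑ j, K.P i j * Real.cos (K.φ i j))
      - Matrix.of (fun i j => K.P i j * Real.cos (K.φ i j))).IsHermitian)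
    {ρ μ m M MH T : ℝ} (hρ0 : 0 < ρ) (hρπ : ρ ≤ Real.pi) (hμ : 0 < μ)
    (hm0 : 0 < m) (hm : ∀ i j, i ≠ j → m ≤ K.D i * K.D j) (hM : ∀ i j, i ≠ j → K.D i * K.D j ≤ M)
    (hMnn : 0 ≤ M) (hsq : M * μ ^ 2 ≤ m * ρ ^ 2) (hMH0 : 0 ≤ MH)
    (hMH : 1 / 2 * ∑ i, ∑ j,
      (|K.ω i / K.D i - K.ω j / K.D j| + ∑ k, K.b i k + ∑ k, K.b j k) ^ 2 ≤ MH ^ 2)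
    (hkey : M * MH < K.kappa * (Real.sin ρ / ρ) * (hL.eigenvalues₀ ⟨n - 2, by simp; omega⟩ / n) * μ)
    {θ : ℝ → Fin n → ℝ} (hθ : ∀ t ∈ Icc 0 T, HasDerivWithinAt θ (K.field (θ t)) (Icc 0 T) t)
    (h0 : M * pairNormSq (θ 0) ≤ m * ρ ^ 2) :
    (∀ t ∈ Icc 0 T, pairNormSq (θ t) ≤ ρ ^ 2 ∧ θ t ∈ arcPolytope n ρ) ∧
    (T ≤ (m * ρ ^ 2 - M * μ ^ 2) / (μ * (K.kappa * (Real.sin ρ / ρ)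
        * (hL.eigenvalues₀ ⟨n - 2, by simp; omega⟩ / n) * μ - M * MH)) →
      ∀ t ∈ Icc 0 T, m * pairNormSq (θ t)
        ≤ m * ρ ^ 2 - μ * (K.kappa * (Real.sin ρ / ρ)
          * (hL.eigenvalues₀ ⟨n - 2, by simp; omega⟩ / n) * μ - M * MH) * t) := by
  have hw0 : ∀ i j, 0 ≤ K.P i j * Real.cos (K.φ i j) := fun i j =>
    mul_nonneg (hP i j) (Real.cos_nonneg_of_mem_Icc ⟨by linarith [hφ0 i j, Real.pi_pos], hφ i j⟩)
  exact K.two_norm_cohesive_of_le_algConn hn hD hP hφ0 hφ hsymm hL hρ0 hρπ hμ hm0 hm hM hMnn hsq hMH0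
    hMH (algConn_weights_nonneg hn _ hsymm hw0 hL) le_rfl hkey hθ h0

/-- ★★★ **THEOREM 5.1 2) / 5.5 2) (exponential frequency synchronization) WITH `λ₂(L(Pᵢⱼ))` BY
NAME** (lossless `φ = 0`): the tree's `frequency_sync_to_syncFreq` with `hlam` discharged from any
`0 ≤ λ ≤ λ₂(L(Pᵢⱼ))`: along every solution on `[0, T]` staying in `Δ̄(γ)`, `γ ≤ π/2`,
`Dᵢ(θ̇ᵢ(t) − Ω)² ≤ E₀ e^{−2λ_fe t}`, `λ_fe = λ cos γ κ²/(n ΣDᵢ² D_max)`.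
[cite: DorflerBullo2012, arXiv:0910.5673 §5.1 Thm 5.1 2) and §5.2 Thm 5.5 2) («frequency synchronization») with Lemma 5.9] -/
theorem frequency_sync_of_le_algConn (hn : 2 ≤ n) (hD : ∀ i, 0 < K.D i) (hP : ∀ i j, 0 ≤ K.P i j)
    (hφ : ∀ i j, K.φ i j = 0) (hsymm : ∀ i j, K.P i j = K.P j i)
    (hL : (diagonal (fun i => ∑ j, K.P i j) - Matrix.of K.P).IsHermitian)
    {γ lam Dmax T : ℝ} (hγ0 : 0 ≤ γ) (hγ : γ ≤ Real.pi / 2) (hlam0 : 0 ≤ lam)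
    (hle : lam ≤ hL.eigenvalues₀ ⟨n - 2, by simp; omega⟩)
    (hDmax : ∀ i, K.D i ≤ Dmax)
    {θ : ℝ → Fin n → ℝ} (hθ : ∀ t ∈ Icc 0 T, HasDerivWithinAt θ (K.field (θ t)) (Icc 0 T) t)
    (hinv : ∀ t ∈ Icc 0 T, θ t ∈ arcPolytope n γ) :
    ∀ t ∈ Icc 0 T, ∀ i, K.D i * (K.field (θ t) i - K.syncFreq) ^ 2
      ≤ (∑ j, K.D j * (K.field (θ 0) j - K.syncFreq) ^ 2) *
        Real.exp (-(2 * (lam * Real.cos γ * K.kappa ^ 2 / (n * (∑ j, K.D j ^ 2) * Dmax))) * t) := by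
  have hlam := pairCertificate_of_le_algConn_weights hn K.P hsymm hP hL hle
  exact K.frequency_sync_to_syncFreq hD hP hφ hsymm hγ0 hγ hlam0 hlam hDmax hθ hinv

end NonuniformKuramoto

/-! ### §3. The droop-controlled all-inverter microgrid (SPDB2013 Lemma 1): the same with
`λ₂(L(aᵢⱼ))`, `aᵢⱼ = EᵢEⱼ|Yᵢⱼ|`, BY NAME -/

namespace DroopNetwork

variable {n : ℕ} (N : DroopNetwork n)

/-- ★★★ **PHASE COHESIVENESS OF THE LOSSLESS DROOP MICROGRID WITH `λ₂(L(a))` BY NAME** — the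
tree's `DroopNetwork.two_norm_cohesive` with its connectivity certificate discharged from any
`0 ≤ λ ≤ λ₂(diag(a𝟙) − a)`, `aᵢⱼ = EᵢEⱼ|Yᵢⱼ|` the (symmetric, non-negative) coupling weights of the
all-inverter network; all other hypotheses and conclusions verbatim.  MODELLED: lossless lines,
constant amplitudes, no load buses.
[cite: DorflerBullo2012, arXiv:0910.5673 §5.2 Thm 5.5 statement 1) with Lemma 5.9; SimpsonporcoDorflerBullo2013, §3 Lemma 1] -/
theorem two_norm_cohesive_of_le_algConn (hn : 2 ≤ n) (hD : ∀ i, 0 < N.Dc i) (ha : ∀ i j, 0 ≤ N.a i j)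
    (hasymm : ∀ i j, N.a i j = N.a j i)
    (hL : (diagonal (fun i => ∑ j, N.a i j) - Matrix.of N.a).IsHermitian)
    {ρ μ m M MH lam T : ℝ} (hρ0 : 0 < ρ) (hρπ : ρ ≤ Real.pi) (hμ : 0 < μ)
    (hm0 : 0 < m) (hm : ∀ i j, i ≠ j → m ≤ N.Dc i * N.Dc j)
    (hM : ∀ i j, i ≠ j → N.Dc i * N.Dc j ≤ M) (hMnn : 0 ≤ M) (hsq : M * μ ^ 2 ≤ m * ρ ^ 2)
    (hMH0 : 0 ≤ MH)
    (hMH : 1 / 2 * ∑ i, ∑ j, |N.Pstar i / N.Dc i - N.Pstar j / N.Dc j| ^ 2 ≤ MH ^ 2)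
    (hlam0 : 0 ≤ lam) (hle : lam ≤ hL.eigenvalues₀ ⟨n - 2, by simp; omega⟩)
    (hkey : M * MH < (∑ k, N.Dc k) * (Real.sin ρ / ρ) * (lam / n) * μ)
    {θ : ℝ → Fin n → ℝ} (hsol : ∀ t ∈ Icc 0 T, N.IsSolutionAt θ t)
    (h0 : M * pairNormSq (θ 0) ≤ m * ρ ^ 2) :
    (∀ t ∈ Icc 0 T, pairNormSq (θ t) ≤ ρ ^ 2 ∧ θ t ∈ arcPolytope n ρ) ∧
    (T ≤ (m * ρ ^ 2 - M * μ ^ 2) / (μ * ((∑ k, N.Dc k) * (Real.sin ρ / ρ) * (lam / n) * μ - M * MH)) →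
      ∀ t ∈ Icc 0 T, m * pairNormSq (θ t)
        ≤ m * ρ ^ 2 - μ * ((∑ k, N.Dc k) * (Real.sin ρ / ρ) * (lam / n) * μ - M * MH) * t) :=
  N.two_norm_cohesive hD ha hasymm hρ0 hρπ hμ hm0 hm hM hMnn hsq hMH0 hMH hlam0
    (pairCertificate_of_le_algConn_weights hn N.a hasymm ha hL hle) hkey hsol h0

/-- ★★★ **EXPONENTIAL FREQUENCY SYNCHRONIZATION OF THE LOSSLESS DROOP MICROGRID WITH `λ₂(L(a))` BY
NAME** — the tree's `DroopNetwork.disagreement_decay` with `hlam` discharged from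
`0 ≤ λ ≤ λ₂(diag(a𝟙) − a)`: `E(t) ≤ E(0)·e^{−2λ_fe t}`, `λ_fe = λ cos γ (ΣDᵢ)²/(n ΣDᵢ² D_max)`,
`E = ΣDᵢ(θ̇ᵢ − Ω)²`, `Ω = ΣPᵢ*/ΣDᵢ`.
[cite: DorflerBullo2012, arXiv:0910.5673 §5.1 Thm 5.1 statement 2) with Lemma 5.9; SimpsonporcoDorflerBullo2013, §3 Lemma 1, Thm 2] -/
theorem disagreement_decay_of_le_algConn (hn : 2 ≤ n) (hD : ∀ i, 0 < N.Dc i) (ha : ∀ i j, 0 ≤ N.a i j)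
    (hasymm : ∀ i j, N.a i j = N.a j i)
    (hL : (diagonal (fun i => ∑ j, N.a i j) - Matrix.of N.a).IsHermitian)
    {γ lam Dmax T : ℝ} (hγ0 : 0 ≤ γ) (hγ : γ ≤ Real.pi / 2)
    (hlam0 : 0 ≤ lam) (hle : lam ≤ hL.eigenvalues₀ ⟨n - 2, by simp; omega⟩)
    (hDmax : ∀ i, N.Dc i ≤ Dmax)
    {θ : ℝ → Fin n → ℝ} (hsol : ∀ t ∈ Icc 0 T, N.IsSolutionAt θ t)
    (hinv : ∀ t ∈ Icc 0 T, θ t ∈ arcPolytope n γ) :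
    ∀ t ∈ Icc 0 T, ∑ i, N.Dc i * (N.toKuramoto.field (θ t) i - N.toKuramoto.syncFreq) ^ 2
      ≤ (∑ i, N.Dc i * (N.toKuramoto.field (θ 0) i - N.toKuramoto.syncFreq) ^ 2) *
        Real.exp (-(2 * (lam * Real.cos γ * (∑ k, N.Dc k) ^ 2 /
          (n * (∑ i, N.Dc i ^ 2) * Dmax))) * t) :=
  N.disagreement_decay hD ha hasymm hγ0 hγ hlam0
    (pairCertificate_of_le_algConn_weights hn N.a hasymm ha hL hle) hDmax hsol hinv

end DroopNetwork

end Literature.MathematicalPhysics.PowerSystems
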